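import Literature.NumberTheory.EllipticCurves.CongruenceVisibilityMultiplicativeTwisted
import Summits.BirchSwinnertonDyer.Rank1Residual.X11a.SelmerCompanionTateLineDatum
import Summits.BirchSwinnertonDyer.Rank1Residual.X11a.SelmerCompanionTwoLines
import Literature.NumberTheory.EllipticCurves.KodairaNeronUnramifiedInertiaProofs
import Mathlib.FieldTheory.Galois.Infinite
import HarnessLib

/-!
# Route (3e) SELMER COMPANION, XXX: the OPPOSITE-TWIST kill kind — two multiplicative curves of
# opposite twist type at a place `v` (class X11a = N7; cell `b2b-bsdres`, unit `b2b-bsdres-x11a`,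
# gen 30)

HONEST FRAMING (run/shared/lean/b2b/bsd-rank1-residual/, verbatim in every file): the goal of the
cell is to DELETE the COMBINATION-SHAPED residual classes of the Birch–Swinnerton-Dyer formula for
ALL analytic-rank `≤ 1` elliptic curves over `ℚ` — "full BSD formula for every rank `≤ 1` curve in
class `C`" assembled STRICTLY from published theorems — so that the rank-`≤ 1` remainder becomes
exactly the CONSTRUCTION-SHAPED classes, which are TYPED (missing-input `Prop`s), NOT attempted.
This is not "finishing BSD". CLASS-OWNERS.md: research routes; NO CLAIM BEYOND STATED CLASSES.
THEOREMS ONLY; nothing booked; no label moves. CONDITIONAL on the PUBLISHED named fact A41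
(`hU : Silverman1994_thmV53_corV54_tateUniformisation`, twisted Tate uniformisation).

## What this file proves

Kind (iii) (tree `h1Equiv_mem_selmerLocalKer_of_hasMultiplicativeReductionAt`) gives `ι_v = 1` at a
place where `E` and `A` are multiplicative of the SAME twist type. When the twist types are
OPPOSITE (one `γ = −c₄/c₆` a square in `K_v`, the other not — possible for `p`-congruent curves only
when `χ̄_p|Γ_{K_v}` is the unramified quadratic character; census v7: cells `102966m1`, `384054j1` at
`p = 3`, `v = 2`), `ι_v = p` but the place is a KILL place: `res_h1Equiv_eq_zero_of_opposite_twist`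
— **every class of `θ_* 𝓢_v(E) ∩ 𝓢_v(A)` restricts to ZERO in `H¹(K_v, A[p])`**, the hypothesis
`hkill` of the strict shapes (file XVI; file XXVII `bsdp_of_selmerCompanion_agree_kill`).
PROOF. Tate-line forms (file VII-b) for `φ` (datum of `E`) and `θφ` (datum of `A`):
`Ψ_A(ζ_σ) − G Ψ_E(ζ'_σ) = σC − C` with `C` `p`-torsion, `G` the transport along `θ`. The lines
`L₁ = G Ψ_E(Z)`, `L₂ = Ψ_A(Z)` are `Γ_{K_v}`-stable with eigenvalues `k(σ)ε_E(σ)`, `k(σ)ε_A(σ)`; an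
element `σ₀` fixing exactly one of `√γ(E)`, `√γ(A)` has `ε_E(σ₀) ≠ ε_A(σ₀)`, so `L₁ ∉ ℤL₂` (`p` odd,
file XXIX), `C = jL₁ + iL₂` (tree `Iwasawa.PrimeTorsionLine.exists_eq_nsmul_add_nsmul`), and the
`ℤL₂`-component reads `Ψ_A(ζ_σ) = i(σL₂ − L₂)`: the restriction of `θφ` is the coboundary of the
`p`-TORSION point `iL₂ + T`. Not a class theorem; nothing booked.

References: [SilvermanATAEC1994] Ch. V Lemma 5.2 (c), Thm. 5.3 (a),(b), Cor. 5.4, Ex. 5.11;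
[SilvermanAEC2009] Cor. III.6.4(b); files VII-b, XVI, XXII, XXVII, XXIX;
HOME/b2b-bsdres-x11a/REPORT-g30.md §3(a).
-/

set_option autoImplicit false

noncomputable section

open scoped Classical NNReal

open WeierstrassCurve Literature.NumberTheory.EllipticCurves
  Literature.NumberTheory.GaloisRepresentations Field NumberField IsDedekindDomain
  IsDedekindDomain.HeightOneSpectrum
  Literature.NumberTheory.EllipticCurves.Rank1Residual
  Literature.NumberTheory.EllipticCurves.Rank1Residual.Typed
  Summit.BirchSwinnertonDyer.Rank1Residual.Iwasawa

namespace Summit.BirchSwinnertonDyer.Rank1Residual.X11a.SelmerCompanion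

section Local

open TwoLines

variable {K : Type} [Field K] [NumberField K] (W : WeierstrassCurve K) [W.IsElliptic]
  {p : ℕ} [hp : Fact p.Prime] (v : HeightOneSpectrum (𝓞 K))

set_option maxHeartbeats 1600000 in
/-- **The opposite-twist KILL kind (vii).** `E = W`, `A` elliptic over a number field `K`, `p` odd,
`θ : E[p] ≃ A[p]` `Γ_K`-equivariant, `v` a finite place where BOTH curves are multiplicative of
OPPOSITE twist type (`γ(E)` a square in `K_v` and `γ(A)` not, or vice versa; Silverman *ATAEC*
V.5.2–5.3). Then every class of `θ_* 𝓢_v(E) ∩ 𝓢_v(A)` restricts to zero in `H¹(K_v, A[p])` (the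
`hkill` of files XVI / XXVII). Proof in the module docstring. CONDITIONAL on A41 (`hU`).
[cite: SilvermanATAEC1994, Ch. V Lemma 5.2 (c), Thm. 5.3 (a),(b), Cor. 5.4]
[cite: SilvermanAEC2009, Cor. III.6.4(b)] -/
theorem res_h1Equiv_eq_zero_of_opposite_twist
    (hU : Silverman1994_thmV53_corV54_tateUniformisation.{0}) (hp2 : p ≠ 2)
    (A : WeierstrassCurve K) [A.IsElliptic]
    (θ : geomTorsion W (p : ℤ) ≃+ geomTorsion A (p : ℤ))
    (hθ : ∀ (σ : absoluteGaloisGroup K) (P : geomTorsion W (p : ℤ)), θ (σ • P) = σ • θ P)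
    (hW : W.HasMultiplicativeReductionAt v) (hA : A.HasMultiplicativeReductionAt v)
    (hopp : ((∃ r : v.adicCompletion K, algebraMap K (v.adicCompletion K) (-(W.c₄ / W.c₆)) = r ^ 2) ∧
        (∀ r : v.adicCompletion K, algebraMap K (v.adicCompletion K) (-(A.c₄ / A.c₆)) ≠ r ^ 2)) ∨
      ((∀ r : v.adicCompletion K, algebraMap K (v.adicCompletion K) (-(W.c₄ / W.c₆)) ≠ r ^ 2) ∧
        (∃ r : v.adicCompletion K, algebraMap K (v.adicCompletion K) (-(A.c₄ / A.c₆)) = r ^ 2)))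
    {c : galH1Torsion W (p : ℤ)} (hc : c ∈ selmerLocalKer W (v.adicCompletion K) (p : ℤ))
    (hcA : h1Equiv θ hθ c ∈ selmerLocalKer A (v.adicCompletion K) (p : ℤ)) :
    galoisCohomology.res (A.torsionGaloisModule (p : ℤ)) (v.adicCompletion K) 1 (h1Equiv θ hθ c)
      = 0 := by
  have hpp : p.Prime := hp.out
  haveI : CharZero (v.adicCompletion K) := charZero_adicCompletion v
  have hn : (p : ℤ) ≠ 0 := by exact_mod_cast hpp.ne_zero
  have hp2' : ¬ (p : ℤ) ∣ 2 := fun h ↦ by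
    have h' : p ∣ 2 := by exact_mod_cast h
    exact hp2 ((Nat.prime_dvd_prime_iff_eq hpp Nat.prime_two).mp h')
  obtain ⟨q, t, Φ, hq0, hq1, -, ht2, -, hker, hequiv₀, hrat⟩ := hU A v hA
  obtain ⟨q', t', Φ', hq0', hq1', -, ht2', -, hker', hequiv₀', hrat'⟩ := hU W v hW
  have hfix_of_sq : ∀ {s : AlgebraicClosure (v.adicCompletion K)} {γ : v.adicCompletion K},
      s ^ 2 = algebraMap (v.adicCompletion K) (AlgebraicClosure (v.adicCompletion K)) γ →
      (∃ r : v.adicCompletion K, γ = r ^ 2) →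
      ∀ σ : absoluteGaloisGroup (v.adicCompletion K),
        Field.absoluteGaloisGroup.toAlgEquiv (v.adicCompletion K) σ s = s := by
    intro s γ hs ⟨r, hr⟩ σ
    have h : s ^ 2 = (algebraMap (v.adicCompletion K) (AlgebraicClosure (v.adicCompletion K)) r)
        ^ 2 := by rw [hs, hr, map_pow]
    rcases sq_eq_sq_iff_eq_or_eq_neg.mp h with h | h
    · rw [h, AlgEquiv.commutes]
    · rw [h, map_neg, AlgEquiv.commutes]
  have hmove_of_nsq : ∀ {s : AlgebraicClosure (v.adicCompletion K)} {γ : v.adicCompletion K},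
      s ^ 2 = algebraMap (v.adicCompletion K) (AlgebraicClosure (v.adicCompletion K)) γ →
      (∀ r : v.adicCompletion K, γ ≠ r ^ 2) →
      ∃ σ : absoluteGaloisGroup (v.adicCompletion K),
        Field.absoluteGaloisGroup.toAlgEquiv (v.adicCompletion K) σ s ≠ s := by
    intro s γ hs hγ
    by_contra hall
    push Not at hall
    haveI := isGalois_algebraicClosure_adicCompletion (v := v) (K := K)
    have hmem : s ∈ (⊥ : IntermediateField (v.adicCompletion K)
        (AlgebraicClosure (v.adicCompletion K))) := by
      rw [InfiniteGalois.mem_bot_iff_fixed]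
      intro f
      have hf := hall ((Field.absoluteGaloisGroup.toAlgEquiv (v.adicCompletion K)).symm f)
      rwa [MulEquiv.apply_symm_apply] at hf
    obtain ⟨r, hr⟩ := IntermediateField.mem_bot.mp hmem
    refine hγ r ((algebraMap (v.adicCompletion K) (AlgebraicClosure (v.adicCompletion K))).injective
      ?_)
    rw [map_pow, hr, hs]
  obtain ⟨σ₀, hσ₀⟩ : ∃ σ₀ : absoluteGaloisGroup (v.adicCompletion K),
      ¬ (Field.absoluteGaloisGroup.toAlgEquiv (v.adicCompletion K) σ₀ t = t ↔
        Field.absoluteGaloisGroup.toAlgEquiv (v.adicCompletion K) σ₀ t' = t') := by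
    rcases hopp with ⟨hWsq, hAnsq⟩ | ⟨hWnsq, hAsq⟩
    · obtain ⟨σ₀, h0⟩ := hmove_of_nsq ht2 hAnsq
      exact ⟨σ₀, fun h ↦ h0 (h.mpr (hfix_of_sq ht2' hWsq σ₀))⟩
    · obtain ⟨σ₀, h0⟩ := hmove_of_nsq ht2' hWnsq
      exact ⟨σ₀, fun h ↦ h0 (h.mp (hfix_of_sq ht2 hAsq σ₀))⟩
  obtain ⟨ε, hε_of_fix, hε_of_not⟩ : ∃ ε : (absoluteGaloisGroup (v.adicCompletion K)) → ℤ,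
      (∀ σ, Field.absoluteGaloisGroup.toAlgEquiv (v.adicCompletion K) σ t = t → ε σ = 1) ∧
        (∀ σ, Field.absoluteGaloisGroup.toAlgEquiv (v.adicCompletion K) σ t ≠ t → ε σ = -1) :=
    ⟨fun σ ↦ if Field.absoluteGaloisGroup.toAlgEquiv (v.adicCompletion K) σ t = t then 1 else -1,
      fun σ h ↦ if_pos h, fun σ h ↦ if_neg h⟩
  obtain ⟨ε', hε'_of_fix, hε'_of_not⟩ : ∃ ε' : (absoluteGaloisGroup (v.adicCompletion K)) → ℤ,
      (∀ σ, Field.absoluteGaloisGroup.toAlgEquiv (v.adicCompletion K) σ t' = t' → ε' σ = 1) ∧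
        (∀ σ, Field.absoluteGaloisGroup.toAlgEquiv (v.adicCompletion K) σ t' ≠ t' → ε' σ = -1) :=
    ⟨fun σ ↦ if Field.absoluteGaloisGroup.toAlgEquiv (v.adicCompletion K) σ t' = t' then 1 else -1,
      fun σ h ↦ if_pos h, fun σ h ↦ if_neg h⟩
  have hequiv : ∀ (σ : (absoluteGaloisGroup (v.adicCompletion K))) (u : (AlgebraicClosure
      (v.adicCompletion K))ˣ),
      σ • Φ (Additive.ofMul u) = Φ (Additive.ofMul ((Units.map
          (absoluteGaloisGroup.toAlgEquiv _ σ : AlgebraicClosure (v.adicCompletion K)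
          →* AlgebraicClosure (v.adicCompletion K)) u) ^ (ε σ))) := by
    intro σ u
    rw [hequiv₀ σ u, ofMul_zpow, map_zsmul]
    by_cases h : Field.absoluteGaloisGroup.toAlgEquiv (v.adicCompletion K) σ t = t
    · rw [if_pos h, hε_of_fix σ h]
    · rw [if_neg h, hε_of_not σ h]
  have hequiv' : ∀ (σ : (absoluteGaloisGroup (v.adicCompletion K))) (u : (AlgebraicClosure
      (v.adicCompletion K))ˣ),
      σ • Φ' (Additive.ofMul u) = Φ' (Additive.ofMul ((Units.map
          (absoluteGaloisGroup.toAlgEquiv _ σ : AlgebraicClosure (v.adicCompletion K)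
          →* AlgebraicClosure (v.adicCompletion K)) u) ^ (ε' σ))) := by
    intro σ u
    rw [hequiv₀' σ u, ofMul_zpow, map_zsmul]
    by_cases h : Field.absoluteGaloisGroup.toAlgEquiv (v.adicCompletion K) σ t' = t'
    · rw [if_pos h, hε'_of_fix σ h]
    · rw [if_neg h, hε'_of_not σ h]
  have hεσ₀ : ¬ (p : ℤ) ∣ (ε' σ₀ - ε σ₀) := by
    by_cases h : Field.absoluteGaloisGroup.toAlgEquiv (v.adicCompletion K) σ₀ t = t
    · have h' : Field.absoluteGaloisGroup.toAlgEquiv (v.adicCompletion K) σ₀ t' ≠ t' :=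
        fun h' ↦ hσ₀ ⟨fun _ ↦ h', fun _ ↦ h⟩
      rw [hε_of_fix σ₀ h, hε'_of_not σ₀ h', show (-1 : ℤ) - 1 = -2 by norm_num, Int.dvd_neg]
      exact hp2'
    · have h' : Field.absoluteGaloisGroup.toAlgEquiv (v.adicCompletion K) σ₀ t' = t' := by
        by_contra h'; exact hσ₀ ⟨fun h0 ↦ absurd h0 h, fun h0 ↦ absurd h0 h'⟩
      rw [hε_of_not σ₀ h, hε'_of_fix σ₀ h', show (1 : ℤ) - -1 = 2 by norm_num]
      exact hp2'
  obtain ⟨ζ₀, hζ₀⟩ := HasEnoughRootsOfUnity.exists_primitiveRoot (AlgebraicClosure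
      (v.adicCompletion K)) p
  have hZu : IsUnit ζ₀ := hζ₀.isUnit hpp.ne_zero
  set Z : (AlgebraicClosure (v.adicCompletion K))ˣ := hZu.unit with hZdef
  have hZ : IsPrimitiveRoot (Z : (AlgebraicClosure (v.adicCompletion K))) p := by
    rw [hZdef, IsUnit.unit_spec]; exact hζ₀
  have hZp : Z ^ p = 1 :=
    Units.ext (by rw [Units.val_pow_eq_pow_val, hZ.pow_eq_one, Units.val_one])
  have hZ1 : Z ≠ 1 := fun h ↦ hZ.ne_one hpp.one_lt (by rw [h, Units.val_one])
  have hσZ : ∀ σ : absoluteGaloisGroup (v.adicCompletion K), ∃ k : ℕ,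
      Units.map (absoluteGaloisGroup.toAlgEquiv _ σ : AlgebraicClosure (v.adicCompletion K) →*
        AlgebraicClosure (v.adicCompletion K)) Z = Z ^ k := by
    intro σ
    have h1 : ((Units.map (absoluteGaloisGroup.toAlgEquiv _ σ : AlgebraicClosure (v.adicCompletion K)
        →* AlgebraicClosure (v.adicCompletion K)) Z : (AlgebraicClosure (v.adicCompletion K))ˣ) :
        AlgebraicClosure (v.adicCompletion K)) ^ p = 1 := by
      rw [Units.coe_map, MonoidHom.coe_coe, ← map_pow, hZ.pow_eq_one, map_one]
    obtain ⟨k, -, hk⟩ := hZ.eq_pow_of_pow_eq_one h1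
    exact ⟨k, Units.ext (by rw [Units.val_pow_eq_pow_val, hk])⟩
  -- the torsion transfers and `G = pointsMap_A ∘ θ ∘ e'⁻¹` on `E(K̄_v)[p]`
  set e' := W.torsionPointsEquiv (p : ℤ) (E := (v.adicCompletion K)) hn with he'
  set eA := A.torsionPointsEquiv (p : ℤ) (E := (v.adicCompletion K)) hn with heA
  set G : AddSubgroup.torsionBy (localPoints W (v.adicCompletion K)) (p : ℤ) →+ localPoints A
      (v.adicCompletion K) :=
    ((pointsMap A (v.adicCompletion K)).comp (geomTorsion A (p : ℤ)).subtype).comp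
      (θ.toAddMonoidHom.comp e'.symm.toAddMonoidHom) with hG
  have hG_apply : ∀ T, G T = pointsMap A (v.adicCompletion K) ((θ (e'.symm T) : geomTorsion A
      (p : ℤ)) : geomPoints A) := fun T ↦ rfl
  have hGsmul : ∀ (σ : (absoluteGaloisGroup (v.adicCompletion K))) (T : AddSubgroup.torsionBy
      (localPoints W (v.adicCompletion K)) (p : ℤ)), G (σ • T) = σ • G T := by
    intro σ T
    rw [hG_apply, hG_apply, he', torsionPointsEquiv_symm_smul, hθ,
      Literature.NumberTheory.EllipticCurves.AddSubgroup.torsionBy.coe_smul, pointsMap_smul]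
  have hGinj : ∀ T, G T = 0 → T = 0 := by
    intro T hT
    rw [hG_apply, ← map_zero (pointsMap A (v.adicCompletion K))] at hT
    have h1 := pointsMapOfEmb_injective A (closureEmb (K := K) (v.adicCompletion K)) hT
    rw [ZeroMemClass.coe_eq_zero, map_eq_zero_iff θ θ.injective, map_eq_zero_iff _ e'.symm.injective]
      at h1
    exact h1
  have hmem' : ∀ {ζ : (AlgebraicClosure (v.adicCompletion K))ˣ}, ζ ^ p = 1 →
      Φ' (Additive.ofMul ζ) ∈ AddSubgroup.torsionBy (localPoints W (v.adicCompletion K)) (p : ℤ) :=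
    fun hζ ↦ (Submodule.mem_torsionBy_iff _ _).mpr (W.zsmul_map_ofMul_eq_zero_of_pow_eq_one v Φ' hζ)
  -- the two Tate lines in `A(K̄_v)[p]`: `L₁ = G Φ'(Z)` and `L₂ = Φ(Z)`
  set XZ : AddSubgroup.torsionBy (localPoints W (v.adicCompletion K)) (p : ℤ) :=
    ⟨Φ' (Additive.ofMul Z), hmem' hZp⟩ with hXZ
  set L₁ : localPoints A (v.adicCompletion K) := G XZ with hL₁
  set L₂ : localPoints A (v.adicCompletion K) := Φ (Additive.ofMul Z) with hL₂
  have hL₂p : p • L₂ = 0 := by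
    rw [← natCast_zsmul]; exact A.zsmul_map_ofMul_eq_zero_of_pow_eq_one v Φ hZp
  have hL₁p : p • L₁ = 0 := by
    have h0 : (p : ℤ) • XZ = 0 := Subtype.ext (by
      rw [AddSubgroupClass.coe_zsmul, hXZ, AddSubgroup.coe_zero]
      exact W.zsmul_map_ofMul_eq_zero_of_pow_eq_one v Φ' hZp)
    rw [← natCast_zsmul, hL₁, ← map_zsmul, h0, map_zero]
  have hL₂0 : L₂ ≠ 0 := A.map_ofMul_ne_zero_of_pow_eq_one v hq0 hq1 Φ hker hZp hZ1
  have hL₁0 : L₁ ≠ 0 := by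
    intro h0
    have h1 : XZ = 0 := hGinj XZ h0
    have h2 : Φ' (Additive.ofMul Z) = 0 := by
      have := congrArg Subtype.val h1
      rwa [hXZ] at this
    exact W.map_ofMul_ne_zero_of_pow_eq_one v hq0' hq1' Φ' hker' hZp hZ1 h2
  -- the lines are `Γ_{K_v}`-stable: `σ L₂ = (k ε σ) L₂`, `σ L₁ = (k ε' σ) L₁` for `σ Z = Z^k`
  have hL₂σ : ∀ (σ : absoluteGaloisGroup (v.adicCompletion K)) (k : ℕ),
      Units.map (absoluteGaloisGroup.toAlgEquiv _ σ : AlgebraicClosure (v.adicCompletion K) →*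
        AlgebraicClosure (v.adicCompletion K)) Z = Z ^ k → σ • L₂ = ((k : ℤ) * ε σ) • L₂ := by
    intro σ k hk
    rw [hL₂, hequiv σ Z, hk, ← zpow_natCast, ← zpow_mul, ofMul_zpow, map_zsmul]
  have hL₁σ : ∀ (σ : absoluteGaloisGroup (v.adicCompletion K)) (k : ℕ),
      Units.map (absoluteGaloisGroup.toAlgEquiv _ σ : AlgebraicClosure (v.adicCompletion K) →*
        AlgebraicClosure (v.adicCompletion K)) Z = Z ^ k → σ • L₁ = ((k : ℤ) * ε' σ) • L₁ := by
    intro σ k hk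
    have h1 : σ • XZ = ((k : ℤ) * ε' σ) • XZ := Subtype.ext (by
      rw [Literature.NumberTheory.EllipticCurves.AddSubgroup.torsionBy.coe_smul,
        AddSubgroupClass.coe_zsmul, hXZ]
      change σ • Φ' (Additive.ofMul Z) = ((k : ℤ) * ε' σ) • Φ' (Additive.ofMul Z)
      rw [hequiv' σ Z, hk, ← zpow_natCast, ← zpow_mul, ofMul_zpow, map_zsmul])
    rw [hL₁, ← hGsmul, h1, map_zsmul]
  have hL₂mem : ∀ σ : absoluteGaloisGroup (v.adicCompletion K), σ • L₂ ∈ AddSubgroup.zmultiples L₂ := by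
    intro σ
    obtain ⟨k, hk⟩ := hσZ σ
    rw [hL₂σ σ k hk]
    exact AddSubgroup.zsmul_mem _ (AddSubgroup.mem_zmultiples L₂) _
  have hL₁mem : ∀ σ : absoluteGaloisGroup (v.adicCompletion K), σ • L₁ ∈ AddSubgroup.zmultiples L₁ := by
    intro σ
    obtain ⟨k, hk⟩ := hσZ σ
    rw [hL₁σ σ k hk]
    exact AddSubgroup.zsmul_mem _ (AddSubgroup.mem_zmultiples L₁) _
  -- independence: `L₁ ∉ ℤ L₂` (the element `σ₀` has different eigenvalues on the two lines)
  have h12 : L₁ ∉ AddSubgroup.zmultiples L₂ := by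
    obtain ⟨k₀, hk₀⟩ := hσZ σ₀
    have hk₀p : ¬ (p : ℤ) ∣ (k₀ : ℤ) := by
      intro hdvd
      have hd : p ∣ k₀ := by exact_mod_cast hdvd
      obtain ⟨m, rfl⟩ := hd
      have h1 : Units.map (absoluteGaloisGroup.toAlgEquiv _ σ₀ : AlgebraicClosure (v.adicCompletion K)
          →* AlgebraicClosure (v.adicCompletion K)) Z = 1 := by rw [hk₀, pow_mul, hZp, one_pow]
      apply hZ1
      have h2 : (absoluteGaloisGroup.toAlgEquiv _ σ₀ : AlgebraicClosure (v.adicCompletion K) ≃ₐ[_]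
          AlgebraicClosure (v.adicCompletion K)) (Z : AlgebraicClosure (v.adicCompletion K)) = 1 := by
        have := congrArg Units.val h1
        rwa [Units.coe_map, MonoidHom.coe_coe, Units.val_one] at this
      exact Units.ext ((absoluteGaloisGroup.toAlgEquiv _ σ₀).injective (by rw [h2, Units.val_one, map_one]))
    refine not_mem_zmultiples_of_eigenvalues (p := p)
      (DistribSMul.toAddMonoidHom (localPoints A (v.adicCompletion K)) σ₀) hL₂p hL₁0
      (c₁ := (k₀ : ℤ) * ε' σ₀) (c₂ := (k₀ : ℤ) * ε σ₀) (hL₁σ σ₀ k₀ hk₀) (hL₂σ σ₀ k₀ hk₀) ?_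
    rw [← mul_sub]
    intro hdvd
    rcases (Nat.prime_iff_prime_int.mp hpp).dvd_or_dvd hdvd with h | h
    · exact hk₀p h
    · exact hεσ₀ h
  -- the class `c`, its cocycle `φ`, and the two Tate-line forms
  obtain ⟨φ, rfl⟩ :=
    oneCocycleClass_surjective (discreteTopRep (absoluteGaloisGroup K) (geomTorsion W (p : ℤ))) c
  obtain ⟨ζ', T', hζ', hT'p, hφ'⟩ :=
    exists_cocycle_eq_tate_rootOfUnity_of_datum W v hp2 hq0' ht2' hker' hequiv₀' hrat' φ hc
  rw [h1Equiv_oneCocycleClass] at hcA ⊢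
  set φA := contOneCocycles.pullback (ContinuousMonoidHom.id (absoluteGaloisGroup K))
    (resHomOfEquivariant (ContinuousMonoidHom.id (absoluteGaloisGroup K))
      (θ : geomTorsion W (p : ℤ) →+ geomTorsion A (p : ℤ)) hθ) φ with hφA
  obtain ⟨ζ, T, hζ, hTp, hφAσ⟩ :=
    exists_cocycle_eq_tate_rootOfUnity_of_datum A v hp2 hq0 ht2 hker hequiv₀ hrat φA hcA
  have hφA1 : ∀ σ : absoluteGaloisGroup K, (φA.1 σ : geomTorsion A (p : ℤ)) = θ (φ.1 σ) := fun σ ↦ rfl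
  -- transport of the `E`-form: `φ(res σ) = e'⁻¹ Φ'(ζ'_σ) + (res σ • T₀ − T₀)`
  set Tt : AddSubgroup.torsionBy (localPoints W (v.adicCompletion K)) (p : ℤ) :=
    ⟨T', (Submodule.mem_torsionBy_iff _ _).mpr hT'p⟩ with hTt
  set T₀ : geomTorsion W (p : ℤ) := e'.symm Tt with hT₀
  have hT₀ : pointsMap W (v.adicCompletion K) (T₀ : geomPoints W) = T' := by
    rw [hT₀, he', W.pointsMap_torsionPointsEquiv_symm (p : ℤ) hn Tt]
  have hφσ : ∀ σ : (absoluteGaloisGroup (v.adicCompletion K)), φ.1 (resGal (K := K)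
      (v.adicCompletion K) σ) =
      e'.symm ⟨Φ' (Additive.ofMul (ζ' σ)), hmem' (hζ' σ)⟩ + (resGal (K := K)
          (v.adicCompletion K) σ • T₀ - T₀) := by
    intro σ
    apply Subtype.ext
    apply pointsMapOfEmb_injective W (closureEmb (K := K) (v.adicCompletion K))
    change pointsMap W (v.adicCompletion K) _ = pointsMap W (v.adicCompletion K) _
    rw [hφ' σ, AddSubgroup.coe_add, AddSubgroup.coe_sub, map_add (pointsMap W
        (v.adicCompletion K)),
      map_sub (pointsMap W (v.adicCompletion K)),
      Literature.NumberTheory.EllipticCurves.AddSubgroup.torsionBy.coe_smul, pointsMap_smul, hT₀,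
      he', W.pointsMap_torsionPointsEquiv_symm (p : ℤ) hn]
  -- `Φ(ζ_σ) + (σ T − T) = G Φ'(ζ'_σ) + (σ D − D)`, `D = pointsMap_A (θ T₀)`
  set D : localPoints A (v.adicCompletion K) :=
    pointsMap A (v.adicCompletion K) ((θ T₀ : geomTorsion A (p : ℤ)) : geomPoints A) with hD
  have hkey : ∀ σ : absoluteGaloisGroup (v.adicCompletion K),
      Φ (Additive.ofMul (ζ σ)) + (σ • T - T) =
        G ⟨Φ' (Additive.ofMul (ζ' σ)), hmem' (hζ' σ)⟩ + (σ • D - D) := by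
    intro σ
    rw [← hφAσ σ, hφA1, hφσ σ, map_add θ, map_sub θ, AddSubgroup.coe_add, AddSubgroup.coe_sub,
      map_add (pointsMap A (v.adicCompletion K)), map_sub (pointsMap A (v.adicCompletion K)),
      ← hG_apply, hθ, Literature.NumberTheory.EllipticCurves.AddSubgroup.torsionBy.coe_smul,
      pointsMap_smul]
  -- the `p`-torsion point `C = D − T` decomposes along `A(K̄_v)[p] = ℤL₁ + ℤL₂`
  have hDp : p • D = 0 := by
    rw [hD, ← natCast_zsmul, ← map_zsmul, (mem_geomTorsion_iff A _ _).mp (θ T₀).2, map_zero]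
  have hTp' : p • T = 0 := by rw [← natCast_zsmul]; exact hTp
  have hcard : Nat.card {Q : localPoints A (v.adicCompletion K) // p • Q = 0} = p ^ 2 := by
    have h := A.natCard_torsionBy_localPoints (E := v.adicCompletion K) (p : ℤ) hn
    rw [Int.natAbs_natCast] at h
    rw [← h]
    refine Nat.card_congr (Equiv.subtypeEquivRight fun Q ↦ ?_)
    rw [AddSubgroup.torsionBy, Submodule.mem_toAddSubgroup, Submodule.mem_torsionBy_iff,
      natCast_zsmul]
  obtain ⟨j, i, -, -, hC⟩ := PrimeTorsionLine.exists_eq_nsmul_add_nsmul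
    (AddSubgroup.zmultiples L₂) (AddSubgroup.mem_zmultiples L₂) (addOrderOf_eq_prime hL₂p hL₂0) hcard
    hL₁p h12 (Q := D - T) (by rw [smul_sub, hDp, hTp', sub_self])
  -- the witness: `B = i L₂ + T`, transported to `A[p](K̄)`
  have hBp : (p : ℤ) • (i • L₂ + T) = 0 := by
    rw [smul_add, hTp, add_zero, natCast_zsmul, smul_comm, hL₂p, smul_zero]
  set Bt : AddSubgroup.torsionBy (localPoints A (v.adicCompletion K)) (p : ℤ) :=
    ⟨i • L₂ + T, (Submodule.mem_torsionBy_iff _ _).mpr hBp⟩ with hBt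
  rw [res_torsionGaloisModule_oneCocycleClass]
  refine (oneCocycleClass_eq_zero_iff _ _).mpr ⟨eA.symm Bt, fun σ ↦ ?_⟩
  change θ (φ.1 (resGal (K := K) (v.adicCompletion K) σ)) =
    resGal (K := K) (v.adicCompletion K) σ • eA.symm Bt - eA.symm Bt
  -- compare in `A(K̄_v)`
  apply Subtype.ext
  apply pointsMapOfEmb_injective A (closureEmb (K := K) (v.adicCompletion K))
  change pointsMap A (v.adicCompletion K) _ = pointsMap A (v.adicCompletion K) _
  rw [← hφA1, hφAσ σ, AddSubgroup.coe_sub, map_sub (pointsMap A (v.adicCompletion K)),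
    Literature.NumberTheory.EllipticCurves.AddSubgroup.torsionBy.coe_smul, pointsMap_smul, heA,
    A.pointsMap_torsionPointsEquiv_symm (p : ℤ) hn]
  change Φ (Additive.ofMul (ζ σ)) + (σ • T - T) = σ • (i • L₂ + T) - (i • L₂ + T)
  -- the `ℤL₂`-component of `hkey σ`: `Φ(ζ_σ) = i (σ L₂ − L₂)`
  have hx₂ : Φ (Additive.ofMul (ζ σ)) ∈ AddSubgroup.zmultiples L₂ := by
    obtain ⟨k, -, hk⟩ := hZ.eq_pow_of_pow_eq_one (ξ := ((ζ σ : (AlgebraicClosure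
        (v.adicCompletion K))ˣ) : AlgebraicClosure (v.adicCompletion K)))
      (by rw [← Units.val_pow_eq_pow_val, hζ σ, Units.val_one])
    have hζk : ζ σ = Z ^ k := Units.ext (by rw [← hk, Units.val_pow_eq_pow_val])
    rw [hζk, ofMul_pow, map_nsmul]
    exact AddSubgroup.nsmul_mem _ (AddSubgroup.mem_zmultiples L₂) _
  have hx₁ : G ⟨Φ' (Additive.ofMul (ζ' σ)), hmem' (hζ' σ)⟩ ∈ AddSubgroup.zmultiples L₁ := by
    obtain ⟨k, -, hk⟩ := hZ.eq_pow_of_pow_eq_one (ξ := ((ζ' σ : (AlgebraicClosure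
        (v.adicCompletion K))ˣ) : AlgebraicClosure (v.adicCompletion K)))
      (by rw [← Units.val_pow_eq_pow_val, hζ' σ, Units.val_one])
    have hζk : ζ' σ = Z ^ k := Units.ext (by rw [← hk, Units.val_pow_eq_pow_val])
    have hX : (⟨Φ' (Additive.ofMul (ζ' σ)), hmem' (hζ' σ)⟩ : AddSubgroup.torsionBy (localPoints W
        (v.adicCompletion K)) (p : ℤ)) = k • XZ := Subtype.ext (by
      rw [AddSubgroupClass.coe_nsmul, hXZ]
      change Φ' (Additive.ofMul (ζ' σ)) = k • Φ' (Additive.ofMul Z)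
      rw [hζk, ofMul_pow, map_nsmul])
    rw [hX, map_nsmul]
    exact AddSubgroup.nsmul_mem _ (AddSubgroup.mem_zmultiples L₁) _
  have hsplit : Φ (Additive.ofMul (ζ σ)) - G ⟨Φ' (Additive.ofMul (ζ' σ)), hmem' (hζ' σ)⟩ =
      j • (σ • L₁ - L₁) + i • (σ • L₂ - L₂) := by
    have h := hkey σ
    have hσC : σ • (D - T) = j • (σ • L₁) + i • (σ • L₂) := by
      rw [hC, smul_add, smul_comm σ j L₁, smul_comm σ i L₂]
    have e1 : Φ (Additive.ofMul (ζ σ)) - G ⟨Φ' (Additive.ofMul (ζ' σ)), hmem' (hζ' σ)⟩ =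
        σ • (D - T) - (D - T) := by
      rw [smul_sub, eq_sub_of_add_eq h]
      abel
    rw [e1, hσC, hC, nsmul_sub, nsmul_sub]
    abel
  have hcomp := eq_of_sub_eq_add_of_lines (p := p) hL₁p h12 hx₁ hx₂
    (nsmul_sub_mem_zmultiples (hL₁mem σ) j) (nsmul_sub_mem_zmultiples (hL₂mem σ) i) hsplit
  rw [hcomp, smul_add, smul_comm σ i L₂, nsmul_sub]
  abel

end Local

end Summit.BirchSwinnertonDyer.Rank1Residual.X11a.SelmerCompanion

end
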